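import Literature.AlgebraicGeometry.Frobenioids.DivisorMonoidBirationalProp48iv
import Literature.AlgebraicGeometry.Frobenioids.IrreducibleMorphismsCounterexample
import Literature.AlgebraicGeometry.Frobenioids.ElementaryPreFrobenioid
import Literature.AlgebraicGeometry.Frobenioids.ModelFrobenioidFunctor
import Mathlib.CategoryTheory.PUnit
import HarnessLib

/-!
# Frobenioids I, Proposition 4.8 (iv) AS TYPED (`PreFrobenioidData.Prop48iv S B IsOfPreModelType`): the
# universal closure of the schema is false; the instance form at THE birationalization holds

Mochizuki, *The geometry of Frobenioids I: the general theory*, Kyushu J. Math. **62** (2008) 293–400, §4,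
Proposition 4.8 (iv), kurims text p. 88 [cite: MochizukiFrdI2008, Prop. 4.8 (iv) p.88]: "(iv) If `C` is of
isotropic and pre-model type, then so is `C^birat`."

The statement file `DivisorMonoidCategoryTheoreticityDefs.lean` (seat abc-iut-L1-t3) types the item as the
SCHEMA `PreFrobenioidData.Prop48iv S B IsOfPreModelType := S.IsOfIsotropicType → IsOfPreModelType S →
B.ops.IsOfIsotropicType ∧ IsOfPreModelType B.ops` over THREE free binders: the operations `S` of a
pre-Frobenioid, a birationalization DATUM `B : S.BiratData` (a data-only interface — "a data-only interface
admits junk instances — never quantify universally over it", loc. cit.) and a PREDICATE PARAMETER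
`IsOfPreModelType` standing for [FrdI] Def. 2.7 (iii).  The cell's frozen FACT-LIST lists it as row F-1051
(class `preparatory`, kernel_closedness `parametrised`, label «model-witness»).  Its universal closure is
false, and this PROOF-ONLY file (abc-iut cell, block F fact-proving wave, seat abc-iut-f-012; no definition,
no instance) records the kernel census:

* `PreFrobenioidData.not_forall_prop48iv` — ¬∀ over exactly the declaration's binders (universe level `0`),
  from the closed witness `not_prop48iv_standard_junk`: `S :=` the operations of the STANDARD Frobenioid
  `F_{ℤ≥0}` ([FrdI] Def. 1.1 (iii), `StandardFrobenioidExample`; of isotropic type,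
  `StandardFrobenioidExample.isOfIsotropicType`), `IsOfPreModelType := ⊤` (always true), and for `B` the JUNK
  datum whose "birationalization" is the same category with the zero-monoid zero-section structure (every
  arrow linear with trivial divisor, lying over `D = 𝟙` on the nose; `Φ^birat := 1`, unit divisors `:= 1`): the
  arrow `(id, 1, 1)` (`stepOne`) is then an isometric pre-step that is not an isomorphism, so "`C^birat`" is
  NOT of isotropic type and the implication fails.  What the witness exploits: `B` ranges over all terms of
  the data interface and `IsOfPreModelType` over all predicates; nothing is said about print.
* `PreFrobenioidData.prop48iv_schema_census` — the closure is false AND the instance form holds at the SAME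
  Frobenioid: for THE birationalization datum `PreFrobenioid.biratData` of the standard Frobenioid and the
  canonical predicate `S ↦ IsOfPreModelType S.toFunctor`, Prop. 4.8 (iv) as typed HOLDS (abc-iut-w5-d227's
  `PreFrobenioid.prop48iv_biratData_of_isFrobenioid`, by name).

So F-1051 is admissible ONLY at THE data (FACT-LIST class «universal-closure REFUTED; instance form
PROVED»).  Elementary; nothing here bears on [IUTchIII] Cor. 3.12 or takes a side; refuted-as-closure is a
statement about OUR typing's binders, not about the paper.
-/

noncomputable section

namespace Literature.AlgebraicGeometry.Frobenioids

open CategoryTheory StandardFrobenioidExample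

namespace PreFrobenioidData

/-! ### The witness on the standard Frobenioid -/

/-- For the zero-monoid zero-section structure `A ↦ (Base A, 0, 1)` on the (category of the) standard
Frobenioid, the arrow `(id, 1, 1)` is an isometric pre-step which is not an isomorphism; hence that structure
is NOT of isotropic type ([FrdI] Def. 1.2 (iv)). [cite: MochizukiFrdI2008, Def. 1.2 (iv) p.23] -/
theorem not_isOfIsotropicType_zeroSection_standard :
    ¬ PreFrobenioid.IsOfIsotropicType
        (ElemFrobenioid.baseFunctor Φst ⋙ ElemFrobenioid.zeroSection (zeroMonoid.{0} D)) := by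
  intro h
  haveI : IsIso (stepOne A) :=
    h A (stepOne A) rfl ⟨rfl, isIso_D _⟩
  have h0 := dv_eq_zero_of_isIso (stepOne A)
  rw [dv_stepOne] at h0
  exact one_ne_zero h0

/-- **Closed witness**: Prop. 4.8 (iv) AS TYPED fails for the operations of the standard Frobenioid, the
always-true predicate parameter and the JUNK birationalization datum "same category, zero-monoid
zero-section structure". [cite: MochizukiFrdI2008, Prop. 4.8 (iv) p.88] -/
theorem not_prop48iv_standard_junk :
    ¬ (ofFunctor (charFunctor Φst) (ElemFrobenioid.toChar Φst)).Prop48iv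
        { Birat := ElemFrobenioid Φst
          toBirat := 𝟭 _
          obj_surjective := Function.surjective_id
          ops := ofFunctor (zeroMonoid.{0} D)
            (ElemFrobenioid.baseFunctor Φst ⋙ ElemFrobenioid.zeroSection (zeroMonoid.{0} D))
          ops_mon_eq_one := fun _ _ => rfl
          overBase := Functor.punitExt _ _
          phiBirat := fun _ => ⊥
          divBirat := fun _ => 1
          divBirat_mem := fun _ _ => by
            rw [MonoidHom.one_apply]
            exact Subgroup.one_mem _ }
        (fun {X : Type} [Category.{0} X] (_ : PreFrobenioidData.{0} X D) => True) := by
  intro h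
  have hiso : (ofFunctor (charFunctor Φst) (ElemFrobenioid.toChar Φst)).IsOfIsotropicType :=
    (ofFunctor_isOfIsotropicType _).mpr StandardFrobenioidExample.isOfIsotropicType
  have h2 := (h hiso trivial).1
  rw [ofFunctor_isOfIsotropicType] at h2
  exact not_isOfIsotropicType_zeroSection_standard h2

/-! ### The universal closure is false; the instance form holds -/

/-- **The universal closure of the schema `PreFrobenioidData.Prop48iv` is FALSE** (FACT-LIST F-1051: a
schema over a data interface and a predicate parameter, not a hypothesis).  Binders exactly those of the
declaration, universe level `0`. [cite: MochizukiFrdI2008, Prop. 4.8 (iv) p.88] -/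
theorem not_forall_prop48iv :
    ¬ ∀ (C : Type) [Category.{0} C] (D : Type) [Category.{0} D] (S : PreFrobenioidData.{0} C D)
        (B : S.BiratData) (IsOfPreModelType : ∀ {X : Type} [Category.{0} X], PreFrobenioidData.{0} X D → Prop),
        Literature.AlgebraicGeometry.Frobenioids.PreFrobenioidData.Prop48iv S B IsOfPreModelType :=
  fun h => not_prop48iv_standard_junk (h _ _ _ _ _)

/-- **Census of F-1051**: the closure is false, while at THE birationalization datum of the same (standard)
Frobenioid and the canonical "pre-model type" predicate Prop. 4.8 (iv) AS TYPED holds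
(`PreFrobenioid.prop48iv_biratData_of_isFrobenioid`, abc-iut-w5-d227, by name).
[cite: MochizukiFrdI2008, Prop. 4.8 (iv) p.88] -/
theorem prop48iv_schema_census :
    (¬ ∀ (C : Type) [Category.{0} C] (D : Type) [Category.{0} D] (S : PreFrobenioidData.{0} C D)
        (B : S.BiratData) (IsOfPreModelType : ∀ {X : Type} [Category.{0} X], PreFrobenioidData.{0} X D → Prop),
        Literature.AlgebraicGeometry.Frobenioids.PreFrobenioidData.Prop48iv S B IsOfPreModelType) ∧
      (ofFunctor (charFunctor Φst) (ElemFrobenioid.toChar Φst)).Prop48iv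
        (PreFrobenioid.biratData StandardFrobenioidExample.isFrobenioid
          (PreFrobenioid.hasBiratSquares_of_isFrobenioid StandardFrobenioidExample.isFrobenioid))
        (fun S => PreFrobenioid.IsOfPreModelType S.toFunctor) :=
  ⟨not_forall_prop48iv, PreFrobenioid.prop48iv_biratData_of_isFrobenioid StandardFrobenioidExample.isFrobenioid⟩

end PreFrobenioidData

end Literature.AlgebraicGeometry.Frobenioids

end
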